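import Mathlib
import Literature.AlgebraicGeometry.Resolution.WeightedInitialTermsIndexed
import HarnessLib

/-!
# Weighted initial forms over the residue field — ARBITRARY index set / embedding dimension

Topic: `Literature/AlgebraicGeometry/Resolution`. Dimension-general form of `WeightedInitialForms.lean` (`c : Fin 3 → R`): a brick of the
generalisation `Fin 3 → Fin (r+2)` of the tree's expansion-free rendering of Hironaka's characteristic polyhedra (memo
`run/shared/lean/pub/res-hironaka/L/res-L1-w42-stub-3/KEYCLAIM-PORT-PLAN.md` §4–§6). For a local ring `(R, 𝔪, k)`, a family `c : σ → R` and a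
weight `w : σ → ℕ`, the **initial form** of `f ∈ F^{(w)}_n` in degree `n` is the class of `f` in `F_n/F_{n+1}`, a `w`-homogeneous polynomial of
weight `n` over `k` (Cossart–Jannsen–Saito, LNM 2270, Definition 8.2 (2)–(4): `in_v(g)`, `in_{E_L}(g)`; Cossart–Piltant 2008, (13)); for a
regular local ring of dimension `d + 1` with regular system of parameters `c : Fin (d + 1) → R` and positive weights it exists and is unique
(weighted quasi-regularity, `coeff_mem_maximalIdeal_of_weval_mem_weightedOrderIdeal`). Expansion-free definition, as in the `Fin 3` file:
`IsInForm c w n f P` — `P ∈ k[X_σ]` is the reduction of a `w`-homogeneous `F ∈ R[X_σ]` of weight `n` with `f ≡ F(c) mod F_{n+1}`;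
`inForm c w n f` a chosen witness. PROVED (ns `WeightedOrder`; the `Fin 3` statements and proofs verbatim, no facts):

* generic (`c : σ → R`, `R` local): `IsInForm.mem`, `map_residue_eq_zero_iff`, `eval_mem_succ_of_coeff_mem`, `IsInForm.mul`, `IsInForm.add`,
  `IsInForm.smul`, `isInForm_zero_of_mem_succ` (graded ring structure);
* regular, `c : Fin (d + 1) → R`: `IsInForm.exists`, `IsInForm.unique`, `isInForm_inForm`, `IsInForm.eq_inForm`, `inForm_eq_zero_iff`
  (`in_n(f) = 0 ⟺ f ∈ F_{n+1}`), `mem_support_inForm_iff` (support = initial unit terms of weight `n`), `inForm_mul`, `inForm_smul`,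
  `isWeightedHomogeneous_inForm`.

Solvability of vertices (CJS Def. 8.2 (3) / 8.11 for a block of `r` variables `y` and several generators) is deliberately NOT defined here
(memo §6: it is the first non-verbatim point of the generalisation). AI-written; weaker than expert review.

Sources: V. Cossart, U. Jannsen, S. Saito, LNM **2270** (2020), Def. 8.2, Lemma 8.3 [`CossartJannsenSaito2020`]; V. Cossart, O. Piltant,
J. Algebra 320 (2008), §4 (13) [`CossartPiltant2008`]; H. Hironaka, J. Math. Kyoto Univ. 7 (1967), §3 [`Hironaka1967`]. No named facts;
no instance, notation or attribute.
-/

noncomputable section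

open IsLocalRing MvPolynomial

namespace Literature.AlgebraicGeometry.Resolution

namespace WeightedOrder

universe u v

variable {R : Type u} [CommRing R] {σ : Type v}

/-- **`P` is the `w`-initial form of `f` in degree `n`**: `P` is the reduction modulo `𝔪` of a `w`-homogeneous `F ∈ R[X_σ]` of weight `n`
with `f ≡ F(c) mod F^{(w)}_{n+1}`. [cite: CossartJannsenSaito2020, Def. 8.2 (2)] [cite: CossartPiltant2008, §4 (13)] -/
def IsInForm [IsLocalRing R] (c : σ → R) (w : σ → ℕ) (n : ℕ) (f : R) (P : MvPolynomial σ (ResidueField R)) : Prop :=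
  ∃ F : MvPolynomial σ R, F.IsWeightedHomogeneous w n ∧ MvPolynomial.map (residue R) F = P ∧ f - eval c F ∈ weightedOrderIdeal c w (n + 1)

/-- **The `w`-initial form of `f` in degree `n`** (a chosen witness; meaningful when `f ∈ F_n`). [cite: CossartJannsenSaito2020, Def. 8.2 (2)] -/
def inForm [IsLocalRing R] (c : σ → R) (w : σ → ℕ) (n : ℕ) (f : R) : MvPolynomial σ (ResidueField R) :=
  Classical.epsilon (fun P => IsInForm c w n f P)

/-- An element with an initial form in degree `n` lies in `F_n`. [cite: CossartJannsenSaito2020, Def. 8.2 (2)] -/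
theorem IsInForm.mem [IsLocalRing R] {c : σ → R} {w : σ → ℕ} {n : ℕ} {f : R} {P : MvPolynomial σ (ResidueField R)}
    (h : IsInForm c w n f P) : f ∈ weightedOrderIdeal c w n := by
  obtain ⟨F, hF, -, hrem⟩ := h
  have h1 : eval c F ∈ weightedOrderIdeal c w n :=
    eval_mem_weightedOrderIdeal_of_forall_le c w fun m hm => (hF (mem_support_iff.mp hm)).ge
  have h2 := weightedOrderIdeal_antitone c w (Nat.le_succ n) hrem
  have : f = f - eval c F + eval c F := by ring
  rw [this]; exact Ideal.add_mem _ h2 h1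

/-- The reduction of a polynomial with coefficients in `𝔪` is zero, and conversely. [cite: CossartJannsenSaito2020, Lemma 8.3 (1)] -/
theorem map_residue_eq_zero_iff [IsLocalRing R] (F : MvPolynomial σ R) :
    MvPolynomial.map (residue R) F = 0 ↔ ∀ m, F.coeff m ∈ maximalIdeal R := by
  rw [MvPolynomial.ext_iff]
  refine forall_congr' fun m => ?_
  rw [coeff_map, coeff_zero, residue_eq_zero_iff]

/-- A `w`-homogeneous polynomial with coefficients in `𝔪` evaluates into `F_{n+1}` (positive weights, `(c) = 𝔪`).
[cite: CossartJannsenSaito2020, Lemma 8.3 (1)] -/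
theorem eval_mem_succ_of_coeff_mem [IsLocalRing R] (c : σ → R) (hgen : Ideal.span (Set.range c) = maximalIdeal R)
    {w : σ → ℕ} (hw : ∀ i, 0 < w i) {n : ℕ} {F : MvPolynomial σ R} (hF : F.IsWeightedHomogeneous w n)
    (hc : ∀ m, F.coeff m ∈ maximalIdeal R) : eval c F ∈ weightedOrderIdeal c w (n + 1) := by
  rw [F.as_sum, map_sum]
  refine Ideal.sum_mem _ fun m hm => ?_
  rw [eval_monomial_eq_cmonom]
  have hmono : cmonom c m ∈ weightedOrderIdeal c w n := cmonom_mem_weightedOrderIdeal c w (hF (mem_support_iff.mp hm)).ge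
  exact maximalIdeal_mul_weightedOrderIdeal_le c w hw hgen n (Ideal.mul_mem_mul (hc m) hmono)

/-! ### Graded ring structure -/

/-- **Products**: `in_{n+m}(f g) = in_n(f) · in_m(g)`. [cite: CossartJannsenSaito2020, Lemma 8.3] -/
theorem IsInForm.mul [IsLocalRing R] (c : σ → R) {w : σ → ℕ} {n m : ℕ} {f g : R} {P Q : MvPolynomial σ (ResidueField R)}
    (hP : IsInForm c w n f P) (hQ : IsInForm c w m g Q) : IsInForm c w (n + m) (f * g) (P * Q) := by
  have hfn := hP.mem
  obtain ⟨F, hF, rfl, hFrem⟩ := hP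
  obtain ⟨G, hG, rfl, hGrem⟩ := hQ
  refine ⟨F * G, hF.mul hG, by rw [map_mul], ?_⟩
  have : f * g - eval c (F * G) = f * (g - eval c G) + (f - eval c F) * eval c G := by
    rw [map_mul]; ring
  rw [this]
  refine Ideal.add_mem _ ?_ ?_
  · have := weightedOrderIdeal_mul_le c w n (m + 1) (Ideal.mul_mem_mul hfn hGrem)
    rwa [← add_assoc] at this
  · have hGc : eval c G ∈ weightedOrderIdeal c w m :=
      eval_mem_weightedOrderIdeal_of_forall_le c w fun d hd => (hG (mem_support_iff.mp hd)).ge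
    have := weightedOrderIdeal_mul_le c w (n + 1) m (Ideal.mul_mem_mul hFrem hGc)
    rwa [add_right_comm] at this

/-- **Sums**: `in_n(f + g) = in_n(f) + in_n(g)` (same degree). [cite: CossartJannsenSaito2020, Lemma 8.3] -/
theorem IsInForm.add [IsLocalRing R] (c : σ → R) {w : σ → ℕ} {n : ℕ} {f g : R} {P Q : MvPolynomial σ (ResidueField R)}
    (hP : IsInForm c w n f P) (hQ : IsInForm c w n g Q) : IsInForm c w n (f + g) (P + Q) := by
  obtain ⟨F, hF, rfl, hFrem⟩ := hP
  obtain ⟨G, hG, rfl, hGrem⟩ := hQ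
  refine ⟨F + G, hF.add hG, by rw [map_add], ?_⟩
  have : f + g - eval c (F + G) = (f - eval c F) + (g - eval c G) := by rw [map_add]; ring
  rw [this]; exact Ideal.add_mem _ hFrem hGrem

/-- **Scalars**: `in_n(a f) = ā · in_n(f)` for `a ∈ R`. [cite: CossartJannsenSaito2020, Lemma 8.3] -/
theorem IsInForm.smul [IsLocalRing R] (c : σ → R) {w : σ → ℕ} {n : ℕ} {f : R} {P : MvPolynomial σ (ResidueField R)}
    (hP : IsInForm c w n f P) (a : R) : IsInForm c w n (a * f) (C (residue R a) * P) := by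
  obtain ⟨F, hF, rfl, hFrem⟩ := hP
  refine ⟨C a * F, ?_, by rw [map_mul, map_C], ?_⟩
  · intro d hd
    rw [coeff_C_mul] at hd
    exact hF (right_ne_zero_of_mul hd)
  · have : a * f - eval c (C a * F) = a * (f - eval c F) := by rw [map_mul, eval_C]; ring
    rw [this]; exact Ideal.mul_mem_left _ _ hFrem

/-- **Zero in lower degree**: if `f ∈ F_{n+1}` then `0` is an initial form of `f` in degree `n`. [cite: CossartJannsenSaito2020, Lemma 8.3] -/
theorem isInForm_zero_of_mem_succ [IsLocalRing R] (c : σ → R) {w : σ → ℕ} {n : ℕ} {f : R}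
    (hf : f ∈ weightedOrderIdeal c w (n + 1)) : IsInForm c w n f 0 :=
  ⟨0, isWeightedHomogeneous_zero _ _ _, by simp, by simpa using hf⟩

section Regular

variable [IsRegularLocalRing R] {d : ℕ} (c : Fin (d + 1) → R)
  (hgen : Ideal.span (Set.range c) = maximalIdeal R) (hdim : ringKrullDim R = d + 1)

include hgen hdim in
/-- **Existence of initial forms**: every `f ∈ F_n` has a `w`-initial form in degree `n` (the reduction of the weight-`n` component of a unit
representative). [cite: CossartJannsenSaito2020, Def. 8.2] -/
theorem IsInForm.exists {w : Fin (d + 1) → ℕ} (hw : ∀ i, 0 < w i) {n : ℕ} {f : R} (hf : f ∈ weightedOrderIdeal c w n) :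
    ∃ P, IsInForm c w n f P := by
  obtain ⟨F, hFu, -, hFrem⟩ := exists_unitRep_weighted c hgen hw f (n + 1)
  have hmin : ∀ m ∈ F.support, n ≤ Finsupp.weight w m :=
    (mem_weightedOrderIdeal_iff_of_unitRep c hgen hdim hw hFu hFrem (Nat.le_succ n)).mp hf
  refine ⟨MvPolynomial.map (residue R) (weightedHomogeneousComponent w n F), weightedHomogeneousComponent w n F,
    weightedHomogeneousComponent_isWeightedHomogeneous n F, rfl, ?_⟩
  have h3 := eval_sub_component_mem c w hmin
  have : f - eval c (weightedHomogeneousComponent w n F) = (f - eval c F) + eval c (F - weightedHomogeneousComponent w n F) := by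
    rw [map_sub]; ring
  rw [this]; exact Ideal.add_mem _ hFrem h3

include hgen hdim in
/-- **Uniqueness of initial forms** (weighted quasi-regularity). [cite: CossartJannsenSaito2020, Lemma 8.3 (1)] -/
theorem IsInForm.unique {w : Fin (d + 1) → ℕ} (hw : ∀ i, 0 < w i) {n : ℕ} {f : R} {P Q : MvPolynomial (Fin (d + 1)) (ResidueField R)}
    (hP : IsInForm c w n f P) (hQ : IsInForm c w n f Q) : P = Q := by
  obtain ⟨F, hF, rfl, hFrem⟩ := hP
  obtain ⟨G, hG, rfl, hGrem⟩ := hQ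
  rw [← sub_eq_zero, ← map_sub, map_residue_eq_zero_iff]
  have hdiff : eval c (F - G) ∈ weightedOrderIdeal c w (n + 1) := by
    have : eval c (F - G) = (f - eval c G) - (f - eval c F) := by rw [map_sub]; ring
    rw [this]; exact Ideal.sub_mem _ hGrem hFrem
  have hhom := isWeightedHomogeneous_sub hF hG
  have hsupp : ∀ m ∈ (F - G).support, Finsupp.weight w m = n := fun m hm => hhom (mem_support_iff.mp hm)
  exact coeff_mem_maximalIdeal_of_weval_mem_weightedOrderIdeal c hgen hdim w hw hsupp hdiff

include hgen hdim in
/-- `inForm c w n f` is the initial form of `f ∈ F_n`. [cite: CossartJannsenSaito2020, Def. 8.2] -/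
theorem isInForm_inForm {w : Fin (d + 1) → ℕ} (hw : ∀ i, 0 < w i) {n : ℕ} {f : R} (hf : f ∈ weightedOrderIdeal c w n) :
    IsInForm c w n f (inForm c w n f) :=
  Classical.epsilon_spec (IsInForm.exists c hgen hdim hw hf)

include hgen hdim in
/-- Any initial form witness equals `inForm`. [cite: CossartJannsenSaito2020, Lemma 8.3 (1)] -/
theorem IsInForm.eq_inForm {w : Fin (d + 1) → ℕ} (hw : ∀ i, 0 < w i) {n : ℕ} {f : R} {P : MvPolynomial (Fin (d + 1)) (ResidueField R)}
    (hP : IsInForm c w n f P) : P = inForm c w n f :=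
  IsInForm.unique c hgen hdim hw hP (isInForm_inForm c hgen hdim hw hP.mem)

include hgen hdim in
/-- **`in_n(f) = 0 ⟺ f ∈ F_{n+1}`** (for `f ∈ F_n`). [cite: CossartJannsenSaito2020, Lemma 8.3] -/
theorem inForm_eq_zero_iff {w : Fin (d + 1) → ℕ} (hw : ∀ i, 0 < w i) {n : ℕ} {f : R} (hf : f ∈ weightedOrderIdeal c w n) :
    inForm c w n f = 0 ↔ f ∈ weightedOrderIdeal c w (n + 1) := by
  obtain ⟨F, hF, hFP, hFrem⟩ := isInForm_inForm c hgen hdim hw hf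
  constructor
  · intro h0
    rw [h0, map_residue_eq_zero_iff] at hFP
    have h1 := eval_mem_succ_of_coeff_mem c hgen hw hF hFP
    have : f = (f - eval c F) + eval c F := by ring
    rw [this]; exact Ideal.add_mem _ hFrem h1
  · intro hf1
    exact ((isInForm_zero_of_mem_succ c hf1).eq_inForm c hgen hdim hw).symm

include hgen hdim in
/-- **The support of the initial form is the set of initial unit terms** of weight `n`. [cite: CossartJannsenSaito2020, Def. 8.2 (2), Def. 8.5 (4)] -/
theorem mem_support_inForm_iff {w : Fin (d + 1) → ℕ} (hw : ∀ i, 0 < w i) {n : ℕ} {f : R} (hf : f ∈ weightedOrderIdeal c w n)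
    {e : Fin (d + 1) →₀ ℕ} (he : Finsupp.weight w e = n) : e ∈ (inForm c w n f).support ↔ IsInitialTerm c w f e := by
  obtain ⟨F, hF, hFP, hFrem⟩ := isInForm_inForm c hgen hdim hw hf
  rw [← hFP, mem_support_iff, coeff_map, ne_eq, residue_eq_zero_iff]
  constructor
  · intro hu
    have hunit : IsUnit (F.coeff e) := by
      by_contra h; exact hu ((mem_maximalIdeal _).mpr h)
    exact ⟨F, by rwa [he], hunit, by rwa [he]⟩
  · rintro ⟨G, hG, hGu, hGrem⟩ hmem
    -- compare `F` and `G`: `(G - F)(c) ∈ F_{n+1}`, so `coeff_e (G - F) ∈ 𝔪`, so `coeff_e G ∈ 𝔪`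
    rw [he] at hG hGrem
    have hdiff : eval c (G - F) ∈ weightedOrderIdeal c w (n + 1) := by
      have : eval c (G - F) = (f - eval c F) - (f - eval c G) := by rw [map_sub]; ring
      rw [this]; exact Ideal.sub_mem _ hFrem hGrem
    have hhom := isWeightedHomogeneous_sub hG hF
    have hsupp : ∀ m ∈ (G - F).support, Finsupp.weight w m = n := fun m hm => hhom (mem_support_iff.mp hm)
    have hce : (G - F).coeff e ∈ maximalIdeal R := coeff_mem_maximalIdeal_of_weval_mem_weightedOrderIdeal c hgen hdim w hw hsupp hdiff e
    rw [coeff_sub] at hce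
    have : G.coeff e ∈ maximalIdeal R := by
      have := Ideal.add_mem _ hce hmem
      rwa [sub_add_cancel] at this
    exact (mem_maximalIdeal _).mp this hGu

include hgen hdim in
/-- `inForm` of a product. [cite: CossartJannsenSaito2020, Lemma 8.3] -/
theorem inForm_mul {w : Fin (d + 1) → ℕ} (hw : ∀ i, 0 < w i) {n m : ℕ} {f g : R} (hf : f ∈ weightedOrderIdeal c w n)
    (hg : g ∈ weightedOrderIdeal c w m) : inForm c w (n + m) (f * g) = inForm c w n f * inForm c w m g :=
  (((isInForm_inForm c hgen hdim hw hf).mul c (isInForm_inForm c hgen hdim hw hg)).eq_inForm c hgen hdim hw).symm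

include hgen hdim in
/-- `inForm` of a scalar multiple. [cite: CossartJannsenSaito2020, Lemma 8.3] -/
theorem inForm_smul {w : Fin (d + 1) → ℕ} (hw : ∀ i, 0 < w i) {n : ℕ} {f : R} (hf : f ∈ weightedOrderIdeal c w n) (a : R) :
    inForm c w n (a * f) = C (residue R a) * inForm c w n f :=
  (((isInForm_inForm c hgen hdim hw hf).smul c a).eq_inForm c hgen hdim hw).symm

include hgen hdim in
/-- The initial form is `w`-homogeneous of weight `n`. [cite: CossartJannsenSaito2020, Def. 8.2 (2)] -/
theorem isWeightedHomogeneous_inForm {w : Fin (d + 1) → ℕ} (hw : ∀ i, 0 < w i) {n : ℕ} {f : R} (hf : f ∈ weightedOrderIdeal c w n) :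
    (inForm c w n f).IsWeightedHomogeneous w n := by
  obtain ⟨F, hF, hFP, -⟩ := isInForm_inForm c hgen hdim hw hf
  rw [← hFP]
  intro e he
  rw [coeff_map] at he
  exact hF (fun h => he (by rw [h, map_zero]))

end Regular

end WeightedOrder

end Literature.AlgebraicGeometry.Resolution

end
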